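import Summits.CriticalPhenomena.Ising3DConformalLimit.Theses.PrecisionLaplacian
import Literature.MathematicalPhysics.QuantumFieldTheory.MirrorRPKernel

/-!
# Crux `PrecisionLaplacian.StableConeRPRigidity` (stmt-CriticalPhenomena-4800) — negative-side support

Standing crux disprover (cdisprove, gen 3), THEOREM-ONLY file (no definitions, no named facts).  Findings and the
stub audit of the picked line `Cruxes/StableConeRPRigidity/Lines/entire-profile-null-growth.lean`:
`Cruxes/StableConeRPRigidity/Disproof.lean` §S.

* `axialProbe_not_isMirrorRPKernel` — TARGET against the reshaping of stub S5 announced in the lead's `PICKED.md`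
  ("probe with the axial weights `|xᵢ|^{-δ}` … Schur product with the positive-definite Toeplitz matrix
  `[h(s_j - s_l)]`"): for EVERY kernel `K` positive off the origin and every `δ ≠ 0`, the axially probed kernel
  `x ↦ K x * |x₂|^(-δ)` is NOT reflection positive (tree predicate `IsMirrorRPKernel`) in the mirror `e₀ ⊥ e₂`.
  Reason: every diagonal configuration vector `p - θp` lies on the normal line `ℝe₀`, where `x₂ = 0` and the weight
  `|0|^(-δ)` is `+∞` on paper and the junk value `0` in Lean (`Real.zero_rpow`); the configuration `{e₀+e₂, e₀}` with
  coefficients `(1,-1)` has quadratic form `-K(2e₀+e₂) - K(2e₀-e₂) < 0`.  Repair (Disproof §S): regularised weights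
  `(x₂² + ε²)^(-δ/2)` (positive-definite Toeplitz factor; Schur valid for the four mirrors `⊥ e₂` only), `ε → 0` inside
  the X-ray; or keep the registered Riesz probe `‖x‖^(-γ)`, `1 ≤ γ < 3`.
* `periodicTypeLiouville_tight` — TIGHTNESS of stub S3 (`PeriodicTypeLiouville`: a `T`-periodic entire function of
  exponential type `β` with `βT < 2π` is constant): at `βT = 2π` it fails (`cos`, `T = 2π`, `β = 1`).  Hence the
  line's window `β < 4` (period `π/2` from the quarter turn) is exactly where mode extinction stops.
-/

noncomputable section

open scoped BigOperators InnerProductSpace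

namespace Summit.CriticalPhenomena.Ising3DConformalLimit.Theorems.StableConeRPRigidity.Negative

open Literature.MathematicalPhysics.QuantumFieldTheory

/-! ## The coordinate mirror `e₀` -/

/-- The hyperplane reflection written out. -/
theorem reflection_orthogonal_span_apply (n x : EuclideanSpace ℝ (Fin 3)) :
    ((ℝ ∙ n)ᗮ).reflection x = x - (2 * ⟪n, x⟫_ℝ / ‖n‖ ^ 2) • n := by
  rw [Submodule.reflection_orthogonal_apply, Submodule.reflection_singleton_apply]
  simp only [RCLike.ofReal_real_eq_id, id_eq, neg_sub, two_smul]
  rw [← add_smul]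
  congr 1
  ring

/-- `⟪eᵢ, x⟫ = xᵢ`. -/
theorem inner_single_one_left (i : Fin 3) (x : EuclideanSpace ℝ (Fin 3)) :
    ⟪(EuclideanSpace.single i (1:ℝ) : EuclideanSpace ℝ (Fin 3)), x⟫_ℝ = x i := by
  rw [EuclideanSpace.inner_single_left]; simp

/-- `‖eᵢ‖² = 1`. -/
theorem norm_sq_single_one (i : Fin 3) : ‖(EuclideanSpace.single i (1:ℝ) : EuclideanSpace ℝ (Fin 3))‖ ^ 2 = 1 := by
  rw [← real_inner_self_eq_norm_sq, inner_single_one_left]; simp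

/-- Coordinate mirror `eᵢ`: sign flip of the `i`-th coordinate. -/
theorem reflection_single_apply' (i : Fin 3) (x : EuclideanSpace ℝ (Fin 3)) :
    ((ℝ ∙ (EuclideanSpace.single i (1:ℝ) : EuclideanSpace ℝ (Fin 3)))ᗮ).reflection x =
      x - (2 * x i) • EuclideanSpace.single i (1:ℝ) := by
  rw [reflection_orthogonal_span_apply, inner_single_one_left, norm_sq_single_one, div_one]

/-! ## TARGET: the axial probe is not a pointwise RP kernel -/

/-- **The axially probed kernel `K·|x₂|^(-δ)` is not mirror-RP in `e₀` (for any `K > 0` off `0`, any `δ ≠ 0`).**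
Witness configuration `p = (e₀ + e₂, e₀)`, `c = (1, -1)`: the diagonal vectors are `2e₀` (weight `|0|^(-δ) = 0` in
Lean), the off-diagonal ones `2e₀ ± e₂` (weight `1`), so the quadratic form is `-K(2e₀+e₂) - K(2e₀-e₂) < 0`. -/
theorem axialProbe_not_isMirrorRPKernel {K : EuclideanSpace ℝ (Fin 3) → ℝ} (hK : ∀ x, x ≠ 0 → 0 < K x)
    {δ : ℝ} (hδ : δ ≠ 0) :
    ¬ IsMirrorRPKernel (EuclideanSpace.single 0 (1:ℝ)) (fun x => K x * |x 2| ^ (-δ)) := by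
  intro h
  set e0 : EuclideanSpace ℝ (Fin 3) := EuclideanSpace.single 0 (1:ℝ) with he0
  set e2 : EuclideanSpace ℝ (Fin 3) := EuclideanSpace.single 2 (1:ℝ) with he2
  have hpos : ∀ a : Fin 2, 0 < inner ℝ ((![e0 + e2, e0] : Fin 2 → EuclideanSpace ℝ (Fin 3)) a) e0 := by
    intro a
    fin_cases a
    · simp [he0, he2, inner_add_left, EuclideanSpace.inner_single_left]
    · simp [he0]
  have key := h 2 ![e0 + e2, e0] ![1, -1] hpos
  have v00 : (e0 + e2) - ((ℝ ∙ e0)ᗮ).reflection (e0 + e2) = (2:ℝ) • e0 := by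
    rw [he0, he2, reflection_single_apply']
    ext k; fin_cases k <;> simp
  have v01 : (e0 + e2) - ((ℝ ∙ e0)ᗮ).reflection e0 = (2:ℝ) • e0 + e2 := by
    rw [he0, he2, reflection_single_apply']
    ext k; fin_cases k <;> simp
  have v10 : e0 - ((ℝ ∙ e0)ᗮ).reflection (e0 + e2) = (2:ℝ) • e0 - e2 := by
    rw [he0, he2, reflection_single_apply']
    ext k; fin_cases k <;> simp
  have v11 : e0 - ((ℝ ∙ e0)ᗮ).reflection e0 = (2:ℝ) • e0 := by
    rw [he0, reflection_single_apply']
    ext k; fin_cases k <;> simp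
  have c0 : (((2:ℝ) • e0 : EuclideanSpace ℝ (Fin 3)) 2) = 0 := by simp [he0]
  have c1 : (((2:ℝ) • e0 + e2 : EuclideanSpace ℝ (Fin 3)) 2) = 1 := by simp [he0, he2]
  have c2 : (((2:ℝ) • e0 - e2 : EuclideanSpace ℝ (Fin 3)) 2) = -1 := by simp [he0, he2]
  have hz : (0:ℝ) ^ (-δ) = 0 := Real.zero_rpow (neg_ne_zero.mpr hδ)
  have hK1 : 0 < K ((2:ℝ) • e0 + e2) :=
    hK _ (by intro h0; have := congrArg (fun v : EuclideanSpace ℝ (Fin 3) => v 2) h0; simp [he0, he2] at this)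
  have hK2 : 0 < K ((2:ℝ) • e0 - e2) :=
    hK _ (by intro h0; have := congrArg (fun v : EuclideanSpace ℝ (Fin 3) => v 2) h0; simp [he0, he2] at this)
  simp only [Fin.sum_univ_two, Matrix.cons_val_zero, Matrix.cons_val_one, v00, v01, v10, v11,
    c0, c1, c2, abs_zero, abs_one, abs_neg, hz, Real.one_rpow] at key
  linarith

/-! ## TIGHTNESS of the periodic-type Liouville stub -/

/-- **`PeriodicTypeLiouville` is sharp at `βT = 2π`:** `cos` is entire, `2π`-periodic, of exponential type `1`
(`‖cos ω‖ ≤ e^{|Im ω|}`), and not constant. -/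
theorem periodicTypeLiouville_tight :
    ∃ (G : ℂ → ℂ) (T β C : ℝ), 0 < T ∧ 0 ≤ β ∧ β * T = 2 * Real.pi ∧ Differentiable ℂ G ∧
      (∀ ω : ℂ, G (ω + T) = G ω) ∧ (∀ ω : ℂ, ‖G ω‖ ≤ C * Real.exp (β * |ω.im|)) ∧ G 0 ≠ G Real.pi := by
  refine ⟨Complex.cos, 2 * Real.pi, 1, 1, by positivity, zero_le_one, by ring, Complex.differentiable_cos,
    ?_, ?_, ?_⟩
  · intro ω
    push_cast
    exact Complex.cos_add_two_pi ω
  · intro ω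
    have h1 : ‖Complex.exp (ω * Complex.I)‖ ≤ Real.exp |ω.im| := by
      rw [Complex.norm_exp]
      apply Real.exp_le_exp.mpr
      simp [neg_le_abs]
    have h2 : ‖Complex.exp (-ω * Complex.I)‖ ≤ Real.exp |ω.im| := by
      rw [Complex.norm_exp]
      apply Real.exp_le_exp.mpr
      simp [le_abs_self]
    rw [Complex.cos]
    calc ‖(Complex.exp (ω * Complex.I) + Complex.exp (-ω * Complex.I)) / 2‖
        = ‖Complex.exp (ω * Complex.I) + Complex.exp (-ω * Complex.I)‖ / 2 := by
          rw [norm_div]; norm_num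
      _ ≤ (‖Complex.exp (ω * Complex.I)‖ + ‖Complex.exp (-ω * Complex.I)‖) / 2 := by
          gcongr; exact norm_add_le _ _
      _ ≤ (Real.exp |ω.im| + Real.exp |ω.im|) / 2 := by gcongr
      _ = 1 * Real.exp (1 * |ω.im|) := by ring
  · rw [Complex.cos_zero]
    exact_mod_cast (by rw [Complex.cos_pi]; norm_num : (1 : ℂ) ≠ Complex.cos Real.pi)

end Summit.CriticalPhenomena.Ising3DConformalLimit.Theorems.StableConeRPRigidity.Negative

end
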